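import Summits.BirchSwinnertonDyer.BirchSwinnertonDyer.Theses.SignedLowerHalves
import Summits.BirchSwinnertonDyer.Rank1Residual.Supersingular.KobayashiMainConjecture
import Summits.BirchSwinnertonDyer.Rank1Residual.TwoVariableGreenbergMainConjectureAnyRoot
import Literature.NumberTheory.EllipticCurves.Rank1Residual.Typed.X7
import HarnessLib

/-!
# Line `ac2cyc-squeeze` — crux `KobayashiLowerHalfLargeImage` (route SignedLowerHalves, item
# stmt-BirchSwinnertonDyer-19001, rank 3): the ANTICYCLOTOMIC-TO-CYCLOTOMIC SQUEEZE in Greenberg's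
# two-variable `(rel_v, str_v̄)` frame over a Heegner field — ALL analytic ranks, no crossing VALUE needed.

HONEST FRAMING (D-0152): this line feeds the CLASS route K3 = `SignedLowerHalves`; nothing here proves
BSD; every `stub_*` is `sorry`; the compositions only show that the stubs, if proved, give the crux BY
NAME. The squeeze itself (`charIdeal_map_eq_span_of_katoSide_of_acLine`) and its lever
(`span_eq_span_of_dvd_of_constantCoeff_dvd`) are PROVED (no sorry). One stub
(`stub_twoVariable_katoSide`) is OPEN-PROBLEM-SIZED and says so: it is the two-variable zeta element /
Beilinson–Flach bound AT THE TRIVIAL BRANCH, for which no Euler system is in print at a supersingular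
prime (Büyükboduk–Lei need `χ(𝔭) ≠ χ(𝔭ᶜ)`; BCS 2025 fn. 3). This line is the residue-free companion of
`crossing-rigidity`: it is the only line on this crux that reaches `r_an(E) ≥ 2`.

LEVER ("line rigidity"). `Λ_K^ur ≅ 𝒪⟦T₂⟧⟦T₁⟧` (`T₁` cyclotomic = OUTER variable, `T₂` anticyclotomic =
inner; `UnrSeries₂.minus = constantCoeff` is restriction to the anticyclotomic line `T₁ = 0`). If
`A ∣ G` (two-variable Kato side: `(G) ⊆ ch(X_Gr)`), the restrictions to the anticyclotomic line satisfy the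
REVERSE divisibility `G⁻ ∣ A⁻` (anticyclotomic BDP main conjecture EQUALITY + control), and `G⁻ ≠ 0`
(`= 𝓛_p^BDP·unit`, non-zero by Cornut–Vatsal/CGLS), then the cofactor `G/A` has unit constant term along
`T₁`, hence is a unit of `𝒪⟦T₂⟧⟦T₁⟧`: `(A) = (G)` — the full two-variable Greenberg main conjecture.
Descent to the cyclotomic line `T₂ = 0` and the supersingular frame switch (`X_Gr(E/K_∞⁺) ↔ X^±(E/ℚ_∞) ⊕
X^±(E^K/ℚ_∞)`, signed Coleman maps at `v`, `v̄`; CCSS arXiv:1804.10993 Thm. 3.7/§3.3, ordinary template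
Yan–Zhu 2026 Cor. 5.4) with Kato–Kobayashi bounding the twist factor gives `ϖ·L_p^ε(E) ∣ char X^ε(E/ℚ_∞)`,
i.e. `KobayashiLowerDivisibility W p ε`, for EVERY analytic rank (the anticyclotomic equality does not see
`r_an(E)`: generic Heegner non-triviality (Cornut–Vatsal) replaces the crossing value).

DICTIONARY (this crux ↦ the frame). X7 = (`GoodSS W p`, `¬Semistable W`), `a_p = 0`, `Surj W p`, `¬CM`,
`p ≥ 5` (so `ρ_{E,p^∞}` is onto, Serre, and Kato's divisibility is integral). `K` = imaginary quadratic
with the Heegner hypothesis for `N = N_E` (every `ℓ ∣ N` split — additive primes allowed, [CW24, §5]) and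
`p = v v̄` split; `κ₁`/`κ₂` = cyclotomic/anticyclotomic `ℤ_p`-extensions; the frame `(Ω, δ, Ω_p, 𝓛_𝔭(K),
G = L_p^Gr(E/K))` = the tree's `IsKatzMeasure₂` + `IsGreenbergLFunctionAnyRoot₂` value frame (reduction-
type-free, BSTW24 §1.2.1), exactly the data of `TwoVariableIMC.GreenbergTwoVariableMainConjectureAnyRootAt`.

WHY THE ANTICYCLOTOMIC LINE AND NOT A CROSSING POINT. On X7 the curve has non-square-free conductor, so no
Eisenstein/CM congruence engine (GV00, BSTW24 §9, Castella 2018) applies — dead line «BSTW lower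
divisibility unpublished» / DOSSIER-19001 §6. The ONE conductor-blind source of LOWER bounds is Heegner
points, which live on the anticyclotomic line; their Λ-adic input is the EQUALITY in Howard's theorem,
i.e. Λ-PRIMITIVITY of the signed Heegner Kolyvagin system (BBL-II arXiv:2211.03722 Thm. 6.16 (ii)-shape),
ignited by ONE non-vanishing Kolyvagin class (Kolyvagin's conjecture; W. Zhang / `ZhangKolyvaginNonvanishingSS`
on its locus, FREE choice of `K`). Line rigidity then transports the anticyclotomic equality to the whole
`ℤ_p²`-tower PROVIDED the two-variable Kato side holds — and that is the open stub.

DEAD LINES (census): (1) «BSTW lower divisibility unpublished» — not used (no Eisenstein congruence at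
all). (2) x6 `EisensteinHalfFiveLe` refutation history — no quantitative Eisenstein-half statement is made;
`p = 3` is split off only for Kato integrality (`stub_three`, shared verbatim with the slot line).
(3) DOSSIER-19001 §2(e)/§6: FW 7.32 × road K, level-lowering, GV transport — none used. (4) Büyükboduk–Lei
arXiv:1605.05310 Thm. 1.3 as the two-variable bound — EXCLUDED at the trivial branch by their running
hypothesis `χ(𝔭) ≠ χ(𝔭ᶜ)`; recorded as the reason `stub_twoVariable_katoSide` is open, not as its source.
(5) "one extra specialisation" upgrades of the anticyclotomic equality (twisted-line rigidity with one line)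
are FALSE in `𝒪⟦S,T⟧` (`A = T−S`, `G = T−S−S²+s₀S`): a genuine two-variable divisibility is needed.
-/

noncomputable section

open scoped Classical MatrixGroups ModularForm

open PowerSeries NumberField IsDedekindDomain Field CongruenceSubgroup WeierstrassCurve
  Literature.NumberTheory.GaloisRepresentations Literature.NumberTheory.EllipticCurves
  Literature.NumberTheory.EllipticCurves.ModularForms
  Literature.NumberTheory.EllipticCurves.Rank1Residual
  Literature.NumberTheory.EllipticCurves.Rank1Residual.Typed
  Literature.NumberTheory.EllipticCurves.IwasawaAlgebra₂ Literature.NumberTheory.EllipticCurves.UnrSeries₂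
  Literature.NumberTheory.EllipticCurves.GreenbergVatsal2000
  Literature.NumberTheory.EllipticCurves.BurungaleCastellaSkinner2025
  Literature.NumberTheory.EllipticCurves.YanZhu2026
  Summit.BirchSwinnertonDyer.Rank1Residual.Supersingular
  Summit.BirchSwinnertonDyer.Rank1Residual.TwoVariableIMC

set_option linter.dupNamespace false

namespace Summit.BirchSwinnertonDyer.BirchSwinnertonDyer.Cruxes.KobayashiLowerHalfLargeImage

namespace Ac2CycSqueeze

/-! ## The lever (PROVED) -/

/-- **Constant-term rigidity** over a domain: `a ∣ g`, `g(0) ∣ a(0)`, `g(0) ≠ 0` ⟹ `(a) = (g)`. Applied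
with `R = 𝒪⟦T₂⟧` (so "constant term" = restriction to the anticyclotomic line `T₁ = 0`).
[cite: Greenberg1999LNM, Thm. 4.1 and §5 pp. 132–133] -/
theorem span_eq_span_of_dvd_of_constantCoeff_dvd {R : Type*} [CommRing R] [IsDomain R]
    {a g : PowerSeries R} (hag : a ∣ g)
    (h0 : PowerSeries.constantCoeff g ∣ PowerSeries.constantCoeff a)
    (hg0 : PowerSeries.constantCoeff g ≠ 0) :
    Ideal.span {a} = Ideal.span {g} := by
  obtain ⟨h, rfl⟩ := hag
  have ha0 : PowerSeries.constantCoeff a ≠ 0 := by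
    intro ha
    apply hg0
    rw [map_mul, ha, zero_mul]
  obtain ⟨k, hk⟩ := h0
  rw [map_mul] at hk
  have hunit : IsUnit (PowerSeries.constantCoeff h) := by
    have h1 : PowerSeries.constantCoeff a * (PowerSeries.constantCoeff h * k) =
        PowerSeries.constantCoeff a * 1 := by
      rw [mul_one, ← mul_assoc]; exact hk.symm
    exact IsUnit.of_mul_eq_one _ (mul_left_cancel₀ ha0 h1)
  have hU : IsUnit h := (PowerSeries.isUnit_iff_constantCoeff (φ := h)).mpr hunit
  exact (Ideal.span_singleton_mul_right_unit hU a).symm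

/-! ## The frame (vocabulary, INLINED — a workfile may not define propositions)

Every stub below carries, verbatim, two hypothesis blocks over the binders
`(ι K v vbar κ₁ κ₂ γ₁ γ₂ N f Ω δ Ωp LK G)` of `TwoVariableIMC.GreenbergTwoVariableMainConjectureAnyRootAt`:
* DATA (Heegner `p`-split data for `E = W`): `IsNewformOf W f ∧ N = N_E ∧ K` imaginary quadratic `∧`
  (Heeg) for `N ∧ (p) = v v̄` split (`v` induced by `ι`) `∧ κ₁` cyclotomic `∧ κ₂` anticyclotomic — the
  hypotheses of `bcs2025_statement_4_1_2_anyRoot` plus (Heeg);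
  [cite: BurungaleCastellaSkinner2025, §4 standing hypotheses and statement 4.1.2 (arXiv:2405.00270v2 pp. 7–8)]
* FRAME (the Greenberg value frame): `Ω ≠ 0 ∧ δ² = ±D_K ∧ IsKatzMeasure₂ … LK ∧
  IsGreenbergLFunctionAnyRoot₂ … LK G` — verbatim the first four conjuncts of
  `GreenbergTwoVariableMainConjectureAnyRootAt`; [cite: YanZhu2024MainConjNonCM, Def. 3.11 (arXiv:2412.20078v4 TeX l.865–871)]
and the two conclusions that get squeezed:
* KATO SIDE: `X_Gr(E/K_∞)` is `Λ_K`-torsion `∧ ∀ J` compatible, `(G) ⊆ ch(X_Gr)·Λ_K^ur` ("`ch ∣ L_p^Gr`");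
* AC-LINE EQUALITY: `G⁻ ≠ 0 ∧ ∀ J` compatible, `(ch(X_Gr)·Λ_K^ur)|_{T₁=0} = (G⁻)` where restriction to the
  anticyclotomic line is the ring map `constantCoeff : 𝒪⟦T₂⟧⟦T₁⟧ →+* 𝒪⟦T₂⟧` (= `UnrSeries₂.minus` on `G`).
-/


/-! ## The squeeze (PROVED from principality): Kato side + anticyclotomic-line equality ⟹ equality -/

/-- **The squeeze.** If `ch(X_Gr)` is principal, the Kato side `(G) ⊆ (A)` and the anticyclotomic-line
equality `(A)|_{T₁=0} = (G⁻)`, `G⁻ ≠ 0`, force `(A) = (G)` along every compatible `J` — the (Im)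
conclusion of the two-variable main conjecture. Pure commutative algebra over the domain `𝒪⟦T₂⟧`.
[cite: Greenberg1999LNM, Thm. 4.1 and §5 pp. 132–133] -/
theorem charIdeal_map_eq_span_of_katoSide_of_acLine {p : ℕ} [Fact p.Prime]
    (W : WeierstrassCurve ℚ) [W.IsElliptic] [W.IsGloballyMinimal] (K : Type) [Field K] [NumberField K]
    (vbar : HeightOneSpectrum (𝓞 K)) (κ₁ κ₂ : ZpExtension K p) (γ₁ γ₂ : absoluteGaloisGroup K)
    [Fact (ZpExtension.IsTopGeneratorPair κ₁ κ₂ γ₁ γ₂)]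
    (G : PowerSeries (PowerSeries (PadicComplexInt p)))
    (hprinc : (WeierstrassCurve.XGr₂.charIdeal (W.baseChange K) p κ₁ κ₂ vbar γ₁ γ₂).IsPrincipal)
    (hKato : (Module.IsTorsion (IwasawaAlgebra₂ p) ((W.baseChange K).XGr₂ p κ₁ κ₂ vbar γ₁ γ₂) ∧
          ∀ J : ℤ_[p] →+* PadicComplexInt p,
            (∀ x : ℤ_[p], ((J x : PadicComplexInt p) : ℂ_[p]) = ((x : ℚ_[p]) : ℂ_[p])) →
            Ideal.span {G} ≤
              (WeierstrassCurve.XGr₂.charIdeal (W.baseChange K) p κ₁ κ₂ vbar γ₁ γ₂).map (toUnr₂ p J)))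
    (hAc : (minus G ≠ 0 ∧
          ∀ J : ℤ_[p] →+* PadicComplexInt p,
            (∀ x : ℤ_[p], ((J x : PadicComplexInt p) : ℂ_[p]) = ((x : ℚ_[p]) : ℂ_[p])) →
            ((WeierstrassCurve.XGr₂.charIdeal (W.baseChange K) p κ₁ κ₂ vbar γ₁ γ₂).map (toUnr₂ p J)).map
                (PowerSeries.constantCoeff :
                  PowerSeries (PowerSeries (PadicComplexInt p)) →+* PowerSeries (PadicComplexInt p)) =
              Ideal.span {minus G})) :
    ∀ J : ℤ_[p] →+* PadicComplexInt p,
      (∀ x : ℤ_[p], ((J x : PadicComplexInt p) : ℂ_[p]) = ((x : ℚ_[p]) : ℂ_[p])) →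
      (WeierstrassCurve.XGr₂.charIdeal (W.baseChange K) p κ₁ κ₂ vbar γ₁ γ₂).map (toUnr₂ p J) =
        Ideal.span {G} := by
  intro J hJ
  obtain ⟨A, hA⟩ := hprinc
  set A' : PowerSeries (PowerSeries (PadicComplexInt p)) := toUnr₂ p J A with hA'
  have hmap : (WeierstrassCurve.XGr₂.charIdeal (W.baseChange K) p κ₁ κ₂ vbar γ₁ γ₂).map (toUnr₂ p J) =
      Ideal.span {A'} := by
    rw [hA, Ideal.submodule_span_eq, Ideal.map_span, Set.image_singleton]
  rw [hmap]
  -- Kato side: `A' ∣ G`.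
  have hdvd : A' ∣ G := by
    have h := hKato.2 J hJ
    rw [hmap] at h
    exact Ideal.span_singleton_le_span_singleton.mp h
  -- anticyclotomic line: `G⁻ ∣ A'⁻`.
  have hline : PowerSeries.constantCoeff G ∣ PowerSeries.constantCoeff A' := by
    have h := hAc.2 J hJ
    rw [hmap, Ideal.map_span, Set.image_singleton] at h
    have hmem : PowerSeries.constantCoeff A' ∈ Ideal.span {minus G} := h ▸ Ideal.subset_span rfl
    exact Ideal.mem_span_singleton.mp hmem
  exact span_eq_span_of_dvd_of_constantCoeff_dvd hdvd hline hAc.1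

/-! ## Registered stubs -/

/-- **A1 · frame supply** (`stub_frameSupply`): every X7 pair `(W, p)` (`p ≥ 5`, `a_p = 0`, `Surj`,
`¬CM`) admits Heegner `p`-split data and a Greenberg value frame: an embedding datum `ι`, an imaginary
quadratic `K` with (Heeg) for `N_E` and `p` split, the two `ℤ_p`-extensions with a generator pair, the
newform `f_E`, Katz's measure and the two-variable Greenberg/BDP function `L_p^Gr(E/K)` in the
reduction-type-free value frame. WHY PLAUSIBLE: infinitely many Heegner `K` with `p` split (Chebotarev);
modularity; Katz; the construction of `𝓛_p^Gr` "independent of the type of reduction" [BSTW24 §1.2.1,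
§9.3.2; CCSS18 §4]. Size M–L (typing + existence facts, several already in the tree as `Is…` frames).
[cite: BurungaleSkinnerTianWan2024, §1.2.1 and Prop. 9.18 (arXiv:2409.01350)]
[cite: YanZhu2024MainConjNonCM, Thm. 3.9, Thm. 3.10, Def. 3.11 (arXiv:2412.20078v4)] -/
theorem stub_frameSupply :
    ∀ (W : WeierstrassCurve ℚ) [W.IsElliptic] [W.IsGloballyMinimal] (p : ℕ) [Fact p.Prime],
      5 ≤ p → ClassX7 W p → ¬ W.HasCM → W.frobeniusTrace p = 0 → Surj W p →
      ∃ (ι : PadicAlgCl p ≃+* ℂ) (K : Type) (_ : Field K) (_ : NumberField K)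
        (v vbar : HeightOneSpectrum (𝓞 K)) (κ₁ κ₂ : ZpExtension K p) (γ₁ γ₂ : absoluteGaloisGroup K)
        (_ : Fact (ZpExtension.IsTopGeneratorPair κ₁ κ₂ γ₁ γ₂)) (N : ℕ) (_ : NeZero N)
        (f : CuspForm (Gamma0 N) 2) (_ : NeZero (NumberField.discr K).natAbs)
        (Ω δ : ℂ) (Ωp : (unrIntegers p)ˣ) (LK G : PowerSeries (PowerSeries (PadicComplexInt p))),
        (IsNewformOf W f ∧ (N : ℤ) = W.conductorNorm ℤ ∧ IsImaginaryQuadratic K ∧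
          SatisfiesHeegnerHypothesis N K ∧ ((Ideal.span {(p : ℤ)}).primesOver (𝓞 K)).ncard = 2 ∧
          ((p : ℕ) : 𝓞 K) ∈ v.asIdeal ∧ ((p : ℕ) : 𝓞 K) ∈ vbar.asIdeal ∧ vbar ≠ v ∧
          (∀ (w : InfinitePlace K) (k : 𝓞 K), k ∈ v.asIdeal ↔ ‖ι.symm (w.embedding (k : K))‖ < 1) ∧
          κ₁.IsCyclotomic ∧ κ₂.IsAnticyclotomic) ∧
        (Ω ≠ 0 ∧ (δ ^ 2 = (NumberField.discr K : ℂ) ∨ δ ^ 2 = -(NumberField.discr K : ℂ)) ∧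
          IsKatzMeasure₂ ι v vbar ∅ κ₁ κ₂ γ₁⁻¹ γ₂⁻¹ 1 Ω δ ((Ωp : unrIntegers p) : ℂ_[p]) LK ∧
          IsGreenbergLFunctionAnyRoot₂ ι v vbar κ₁ κ₂ γ₁⁻¹ γ₂⁻¹ f (NumberField.discr K).natAbs
            (NumberField.classNumber K) LK G) := by
  sorry

/-- **A2 · anticyclotomic-line equality** (`stub_acLineEquality`): for X7 data and ANY Heegner
`p`-split frame, the anticyclotomic BDP/Greenberg main conjecture holds with EQUALITY and transports
through anticyclotomic control (`X_Gr(E/K_∞)/T₁ → X_Gr(E/K_∞^ac)`, [YZ26 Thm. 4.7 shape; TwoVariable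
AnticyclotomicControl]) to `(ch X_Gr)|_{T₁=0} = (G⁻)`, with `G⁻ = 𝓛_p^BDP·unit ≠ 0` (Cornut–Vatsal).
WHY PLAUSIBLE: the Howard-direction divisibility is Castella–Wan 2024 Thm. 5.12 (`p > 3` good, `Surj`,
(Heeg), additive primes allowed); EQUALITY = Λ-primitivity of the signed Heegner Kolyvagin system
(BBL-II Thm. 6.16 (ii)-shape), ignited by Kolyvagin's conjecture (W. Zhang 2014 on its locus; the tree's
`ZhangKolyvaginNonvanishingSS`; conductor-blind). WHY IT MIGHT FAIL AS A LINE: Kolyvagin's conjecture for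
EVERY Heegner `K` is open off Zhang's locus (♠ fails on part of X7) — XL, contains road K's atom.
[cite: CastellaWan2023, §5.4 Thm. 5.12 (arXiv:1607.02019 p. 21)]
[cite: BurungaleBuyukbodukLei2024, Thm. 6.16 (ii) (arXiv:2211.03722v3 l.3604–3621)] -/
theorem stub_acLineEquality :
    ∀ (W : WeierstrassCurve ℚ) [W.IsElliptic] [W.IsGloballyMinimal] (p : ℕ) [Fact p.Prime],
      5 ≤ p → ClassX7 W p → ¬ W.HasCM → W.frobeniusTrace p = 0 → Surj W p →
      ∀ (ι : PadicAlgCl p ≃+* ℂ) (K : Type) [Field K] [NumberField K]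
        (v vbar : HeightOneSpectrum (𝓞 K)) (κ₁ κ₂ : ZpExtension K p) (γ₁ γ₂ : absoluteGaloisGroup K)
        [Fact (ZpExtension.IsTopGeneratorPair κ₁ κ₂ γ₁ γ₂)] (N : ℕ) [NeZero N]
        (f : CuspForm (Gamma0 N) 2) [NeZero (NumberField.discr K).natAbs]
        (Ω δ : ℂ) (Ωp : (unrIntegers p)ˣ) (LK G : PowerSeries (PowerSeries (PadicComplexInt p))),
        (IsNewformOf W f ∧ (N : ℤ) = W.conductorNorm ℤ ∧ IsImaginaryQuadratic K ∧
          SatisfiesHeegnerHypothesis N K ∧ ((Ideal.span {(p : ℤ)}).primesOver (𝓞 K)).ncard = 2 ∧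
          ((p : ℕ) : 𝓞 K) ∈ v.asIdeal ∧ ((p : ℕ) : 𝓞 K) ∈ vbar.asIdeal ∧ vbar ≠ v ∧
          (∀ (w : InfinitePlace K) (k : 𝓞 K), k ∈ v.asIdeal ↔ ‖ι.symm (w.embedding (k : K))‖ < 1) ∧
          κ₁.IsCyclotomic ∧ κ₂.IsAnticyclotomic) →
        (Ω ≠ 0 ∧ (δ ^ 2 = (NumberField.discr K : ℂ) ∨ δ ^ 2 = -(NumberField.discr K : ℂ)) ∧
          IsKatzMeasure₂ ι v vbar ∅ κ₁ κ₂ γ₁⁻¹ γ₂⁻¹ 1 Ω δ ((Ωp : unrIntegers p) : ℂ_[p]) LK ∧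
          IsGreenbergLFunctionAnyRoot₂ ι v vbar κ₁ κ₂ γ₁⁻¹ γ₂⁻¹ f (NumberField.discr K).natAbs
            (NumberField.classNumber K) LK G) →
        (minus G ≠ 0 ∧
          ∀ J : ℤ_[p] →+* PadicComplexInt p,
            (∀ x : ℤ_[p], ((J x : PadicComplexInt p) : ℂ_[p]) = ((x : ℚ_[p]) : ℂ_[p])) →
            ((WeierstrassCurve.XGr₂.charIdeal (W.baseChange K) p κ₁ κ₂ vbar γ₁ γ₂).map (toUnr₂ p J)).map
                (PowerSeries.constantCoeff :
                  PowerSeries (PowerSeries (PadicComplexInt p)) →+* PowerSeries (PadicComplexInt p)) =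
              Ideal.span {minus G}) := by
  sorry

/-- **A3 · two-variable Kato side** (`stub_twoVariable_katoSide`) — THE OPEN STUB: for X7 data and any
Heegner `p`-split frame, `X_Gr(E/K_∞)` is `Λ_K`-torsion and `(L_p^Gr(E/K)) ⊆ ch(X_Gr(E/K_∞))·Λ_K^ur`.
WHY PLAUSIBLE: it is one half of BCS statement 4.1.2 / YZ statement 4.1 (2), proved at ORDINARY `p` under
(Im) [YZ26 Thm. 4.2 (2)] from Beilinson–Flach classes in Hida families; at supersingular `p` the
two-variable signed Beilinson–Flach bound exists on `p`-distinguished branches [BL 1605.05310 Thm. 1.3,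
Thm. 3.2.1] but NOT at the trivial branch. WHY IT MIGHT FAIL AS A LINE: no Euler system of the right shape
is in print at `χ = 𝟙`, `a_p = 0` (BCS25 fn. 3) — open-problem-sized; the honest heart of this line.
[cite: BurungaleCastellaSkinner2025, statement 4.1.2 and fn. 3 (arXiv:2405.00270v2 pp. 5, 8)]
[cite: arXiv:1605.05310, Büyükboduk–Lei, Thm. 1.3 and Thm. 3.2.1 (pp. 3, 18)] -/
theorem stub_twoVariable_katoSide :
    ∀ (W : WeierstrassCurve ℚ) [W.IsElliptic] [W.IsGloballyMinimal] (p : ℕ) [Fact p.Prime],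
      5 ≤ p → ClassX7 W p → ¬ W.HasCM → W.frobeniusTrace p = 0 → Surj W p →
      ∀ (ι : PadicAlgCl p ≃+* ℂ) (K : Type) [Field K] [NumberField K]
        (v vbar : HeightOneSpectrum (𝓞 K)) (κ₁ κ₂ : ZpExtension K p) (γ₁ γ₂ : absoluteGaloisGroup K)
        [Fact (ZpExtension.IsTopGeneratorPair κ₁ κ₂ γ₁ γ₂)] (N : ℕ) [NeZero N]
        (f : CuspForm (Gamma0 N) 2) [NeZero (NumberField.discr K).natAbs]
        (Ω δ : ℂ) (Ωp : (unrIntegers p)ˣ) (LK G : PowerSeries (PowerSeries (PadicComplexInt p))),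
        (IsNewformOf W f ∧ (N : ℤ) = W.conductorNorm ℤ ∧ IsImaginaryQuadratic K ∧
          SatisfiesHeegnerHypothesis N K ∧ ((Ideal.span {(p : ℤ)}).primesOver (𝓞 K)).ncard = 2 ∧
          ((p : ℕ) : 𝓞 K) ∈ v.asIdeal ∧ ((p : ℕ) : 𝓞 K) ∈ vbar.asIdeal ∧ vbar ≠ v ∧
          (∀ (w : InfinitePlace K) (k : 𝓞 K), k ∈ v.asIdeal ↔ ‖ι.symm (w.embedding (k : K))‖ < 1) ∧
          κ₁.IsCyclotomic ∧ κ₂.IsAnticyclotomic) →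
        (Ω ≠ 0 ∧ (δ ^ 2 = (NumberField.discr K : ℂ) ∨ δ ^ 2 = -(NumberField.discr K : ℂ)) ∧
          IsKatzMeasure₂ ι v vbar ∅ κ₁ κ₂ γ₁⁻¹ γ₂⁻¹ 1 Ω δ ((Ωp : unrIntegers p) : ℂ_[p]) LK ∧
          IsGreenbergLFunctionAnyRoot₂ ι v vbar κ₁ κ₂ γ₁⁻¹ γ₂⁻¹ f (NumberField.discr K).natAbs
            (NumberField.classNumber K) LK G) →
        (Module.IsTorsion (IwasawaAlgebra₂ p) ((W.baseChange K).XGr₂ p κ₁ κ₂ vbar γ₁ γ₂) ∧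
          ∀ J : ℤ_[p] →+* PadicComplexInt p,
            (∀ x : ℤ_[p], ((J x : PadicComplexInt p) : ℂ_[p]) = ((x : ℚ_[p]) : ℂ_[p])) →
            Ideal.span {G} ≤
              (WeierstrassCurve.XGr₂.charIdeal (W.baseChange K) p κ₁ κ₂ vbar γ₁ γ₂).map (toUnr₂ p J)) := by
  sorry

/-- **A4 · principality** (`stub_charIdeal_isPrincipal`): the characteristic ideal of the `Λ₂`-module
`X_Gr(E/K̃_∞)` is principal. WHY PLAUSIBLE: `Λ₂ = ℤ_p⟦T₂⟧⟦T₁⟧` is a regular local ring, hence a UFD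
(Auslander–Buchsbaum), so its height-one primes are principal and `Module.charIdeal = ∏ 𝔭^{ℓ_𝔭}` is
principal (for a non-torsion module the tree's `charIdeal` is a degenerate principal ideal). Size M
(the one-variable analogue is the tree's named fact `charIdeal_isPrincipal`; `ℤ_p⟦X,Y⟧` UFD is not in
Mathlib). [cite: Washington1997, §13.2] [cite: BurungaleCastellaSkinner2025, Thm. 1.4.1 (`ch_{Λ_K}`, p. 4)] -/
theorem stub_charIdeal_isPrincipal :
    ∀ {p : ℕ} [Fact p.Prime] (W : WeierstrassCurve ℚ) [W.IsElliptic] [W.IsGloballyMinimal] (K : Type)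
      [Field K] [NumberField K] (vbar : HeightOneSpectrum (𝓞 K)) (κ₁ κ₂ : ZpExtension K p)
      (γ₁ γ₂ : absoluteGaloisGroup K) [Fact (ZpExtension.IsTopGeneratorPair κ₁ κ₂ γ₁ γ₂)],
      (WeierstrassCurve.XGr₂.charIdeal (W.baseChange K) p κ₁ κ₂ vbar γ₁ γ₂).IsPrincipal := by
  sorry

/-- **A5 · descent to the cyclotomic line and the supersingular frame switch** (`stub_descent`): for X7
data and any Heegner `p`-split frame, the two-variable Greenberg main conjecture (the tree's
`GreenbergTwoVariableMainConjectureAnyRootAt`) yields Kobayashi's LOWER divisibility for `E/ℚ_∞` and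
some sign. HOW: restrict to `T₂ = 0` (cyclotomic control for `X_Gr`, `plus G = 𝓛_p^Gr(E/K)⁺`); on `K_∞⁺`
switch frames `X_Gr(E/K_∞⁺) ↔ X^ε(E/ℚ_∞) ⊕ X^ε(E^K/ℚ_∞)` and `𝓛^Gr⁺ ↔ L_p^ε(E)·L_p^ε(E^K)·(units, log^±)`
with the signed Coleman maps at `v` and `v̄` (both `≅ ℚ_p`, `a_p = 0`) and Poitou–Tate — CCSS Thm. 3.7/§3.3
restricted to the cyclotomic line, ordinary template YZ26 Cor. 5.4 (l.1166–1184); Kato–Kobayashi for the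
twist `E^K` (X7 again: `a_p(E^K) = 0`, `Surj`, `p ≥ 5`) bounds its factor from above, so the equality
isolates `ϖ·L_p^ε(E) ∣ char X^ε(E/ℚ_∞)` = `KobayashiLowerDivisibility W p ε`. WHY IT MIGHT FAIL: the
supersingular switch is printed only two-variably in a PREPRINT (CCSS 2018) and one-variably only for
ordinary `p`; L-sized Coleman-map algebra, every local ingredient in print (Kobayashi 2003 §8, BLLV 2019).
[cite: CastellaCiperianiSkinnerSprung2018, Thm. 3.6, Thm. 3.7, §3.3 (arXiv:1804.10993 pp. 13–15)]
[cite: YanZhu2024MainConjNonCM, Cor. 5.4 (arXiv:2412.20078v4 l.1166–1184)]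
[cite: Kobayashi2003, Thm. 1.3, Thm. 4.1] -/
theorem stub_descent :
    ∀ (W : WeierstrassCurve ℚ) [W.IsElliptic] [W.IsGloballyMinimal] (p : ℕ) [Fact p.Prime],
      5 ≤ p → ClassX7 W p → ¬ W.HasCM → W.frobeniusTrace p = 0 → Surj W p →
      ∀ (ι : PadicAlgCl p ≃+* ℂ) (K : Type) [Field K] [NumberField K]
        (v vbar : HeightOneSpectrum (𝓞 K)) (κ₁ κ₂ : ZpExtension K p) (γ₁ γ₂ : absoluteGaloisGroup K)
        [Fact (ZpExtension.IsTopGeneratorPair κ₁ κ₂ γ₁ γ₂)] (N : ℕ) [NeZero N]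
        (f : CuspForm (Gamma0 N) 2) [NeZero (NumberField.discr K).natAbs],
        (IsNewformOf W f ∧ (N : ℤ) = W.conductorNorm ℤ ∧ IsImaginaryQuadratic K ∧
          SatisfiesHeegnerHypothesis N K ∧ ((Ideal.span {(p : ℤ)}).primesOver (𝓞 K)).ncard = 2 ∧
          ((p : ℕ) : 𝓞 K) ∈ v.asIdeal ∧ ((p : ℕ) : 𝓞 K) ∈ vbar.asIdeal ∧ vbar ≠ v ∧
          (∀ (w : InfinitePlace K) (k : 𝓞 K), k ∈ v.asIdeal ↔ ‖ι.symm (w.embedding (k : K))‖ < 1) ∧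
          κ₁.IsCyclotomic ∧ κ₂.IsAnticyclotomic) →
        GreenbergTwoVariableMainConjectureAnyRootAt ι W K v vbar κ₁ κ₂ γ₁ γ₂ f →
        ∃ ε : ℤˣ, KobayashiLowerDivisibility W p ε := by
  sorry

/-- **A6 · the prime 3** (`stub_three`) — VERBATIM the statement of `KuriharaRigidity.stub_three` and of
`CrossingRigidity.stub_three` (one shared statement across the crux's lines): at `p = 3`, `Surj` mod 3 does
not give `3`-adic surjectivity (Elkies), so Kato's divisibility is not integral in print.
[cite: Kato2004, Thm. 17.4 (pp. 68–69)] [cite: Wuthrich2014, Thm. 4 and §9 (3-adic images)] -/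
theorem stub_three :
    ∀ (W : WeierstrassCurve ℚ) [W.IsElliptic] [W.IsGloballyMinimal] (p : ℕ) [Fact p.Prime],
      p = 3 → ClassX7 W p → ¬ W.HasCM → W.frobeniusTrace p = 0 → Surj W p →
      ∃ ε : ℤˣ, KobayashiLowerDivisibility W p ε := by
  sorry

/-! ## Compositions (PROVED) -/

/-- **A2 + A3 + A4 ⟹ the two-variable main conjecture at the frame** (the squeeze, assembled into the
tree's predicate). [cite: BurungaleCastellaSkinner2025, statement 4.1.2 (arXiv:2405.00270v2 p. 8)] -/
theorem twoVariableMC_of_stubs {p : ℕ} [Fact p.Prime] (ι : PadicAlgCl p ≃+* ℂ)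
    (W : WeierstrassCurve ℚ) [W.IsElliptic] [W.IsGloballyMinimal] (K : Type) [Field K] [NumberField K]
    (v vbar : HeightOneSpectrum (𝓞 K)) (κ₁ κ₂ : ZpExtension K p) (γ₁ γ₂ : absoluteGaloisGroup K)
    [Fact (ZpExtension.IsTopGeneratorPair κ₁ κ₂ γ₁ γ₂)] {N : ℕ} [NeZero N]
    (f : CuspForm (Gamma0 N) 2) [NeZero (NumberField.discr K).natAbs]
    (Ω δ : ℂ) (Ωp : (unrIntegers p)ˣ) (LK G : PowerSeries (PowerSeries (PadicComplexInt p)))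
    (hframe : (Ω ≠ 0 ∧ (δ ^ 2 = (NumberField.discr K : ℂ) ∨ δ ^ 2 = -(NumberField.discr K : ℂ)) ∧
          IsKatzMeasure₂ ι v vbar ∅ κ₁ κ₂ γ₁⁻¹ γ₂⁻¹ 1 Ω δ ((Ωp : unrIntegers p) : ℂ_[p]) LK ∧
          IsGreenbergLFunctionAnyRoot₂ ι v vbar κ₁ κ₂ γ₁⁻¹ γ₂⁻¹ f (NumberField.discr K).natAbs
            (NumberField.classNumber K) LK G))
    (hprinc : (WeierstrassCurve.XGr₂.charIdeal (W.baseChange K) p κ₁ κ₂ vbar γ₁ γ₂).IsPrincipal)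
    (hKato : (Module.IsTorsion (IwasawaAlgebra₂ p) ((W.baseChange K).XGr₂ p κ₁ κ₂ vbar γ₁ γ₂) ∧
          ∀ J : ℤ_[p] →+* PadicComplexInt p,
            (∀ x : ℤ_[p], ((J x : PadicComplexInt p) : ℂ_[p]) = ((x : ℚ_[p]) : ℂ_[p])) →
            Ideal.span {G} ≤
              (WeierstrassCurve.XGr₂.charIdeal (W.baseChange K) p κ₁ κ₂ vbar γ₁ γ₂).map (toUnr₂ p J)))
    (hAc : (minus G ≠ 0 ∧
          ∀ J : ℤ_[p] →+* PadicComplexInt p,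
            (∀ x : ℤ_[p], ((J x : PadicComplexInt p) : ℂ_[p]) = ((x : ℚ_[p]) : ℂ_[p])) →
            ((WeierstrassCurve.XGr₂.charIdeal (W.baseChange K) p κ₁ κ₂ vbar γ₁ γ₂).map (toUnr₂ p J)).map
                (PowerSeries.constantCoeff :
                  PowerSeries (PowerSeries (PadicComplexInt p)) →+* PowerSeries (PadicComplexInt p)) =
              Ideal.span {minus G})) :
    GreenbergTwoVariableMainConjectureAnyRootAt ι W K v vbar κ₁ κ₂ γ₁ γ₂ f :=
  ⟨Ω, δ, Ωp, LK, G, hframe.1, hframe.2.1, hframe.2.2.1, hframe.2.2.2, hKato.1,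
    charIdeal_map_eq_span_of_katoSide_of_acLine W K vbar κ₁ κ₂ γ₁ γ₂ G hprinc hKato hAc⟩

/-- **The `p ≥ 5` lower half from the stubs A1–A5.** -/
theorem lowerHalf_five_le (W : WeierstrassCurve ℚ) [W.IsElliptic] [W.IsGloballyMinimal] (p : ℕ)
    [Fact p.Prime] (hp : 5 ≤ p) (hX7 : ClassX7 W p) (hCM : ¬ W.HasCM) (hap : W.frobeniusTrace p = 0)
    (hS : Surj W p) : ∃ ε : ℤˣ, KobayashiLowerDivisibility W p ε := by
  obtain ⟨ι, K, iF, iNF, v, vbar, κ₁, κ₂, γ₁, γ₂, iγ, N, iN, f, iD, Ω, δ, Ωp, LK, G, hData, hFrame⟩ :=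
    stub_frameSupply W p hp hX7 hCM hap hS
  have hAc := stub_acLineEquality W p hp hX7 hCM hap hS ι K v vbar κ₁ κ₂ γ₁ γ₂ N f Ω δ Ωp LK G hData hFrame
  have hKato :=
    stub_twoVariable_katoSide W p hp hX7 hCM hap hS ι K v vbar κ₁ κ₂ γ₁ γ₂ N f Ω δ Ωp LK G hData hFrame
  have hMC : GreenbergTwoVariableMainConjectureAnyRootAt ι W K v vbar κ₁ κ₂ γ₁ γ₂ f :=
    twoVariableMC_of_stubs ι W K v vbar κ₁ κ₂ γ₁ γ₂ f Ω δ Ωp LK G hFrame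
      (stub_charIdeal_isPrincipal W K vbar κ₁ κ₂ γ₁ γ₂) hKato hAc
  exact stub_descent W p hp hX7 hCM hap hS ι K v vbar κ₁ κ₂ γ₁ γ₂ N f hData hMC

/-- A good supersingular odd prime with `a_p = 0` is `3` or `≥ 5`. -/
theorem three_or_five_le (p : ℕ) [hp : Fact p.Prime] (hp2 : p ≠ 2) : p = 3 ∨ 5 ≤ p := by
  have hpP : p.Prime := hp.out
  by_cases hp5 : 5 ≤ p
  · exact Or.inr hp5
  · left
    have h2le := hpP.two_le
    interval_cases p
    · exact absurd rfl hp2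
    · rfl
    · exact absurd hpP (by decide)

/-- **THE CRUX BY NAME from the six stubs**: `Theses.SignedLowerHalves.KobayashiLowerHalfLargeImage`. -/
theorem KobayashiLowerHalfLargeImage_of :
    Summit.BirchSwinnertonDyer.BirchSwinnertonDyer.Theses.SignedLowerHalves.KobayashiLowerHalfLargeImage := by
  intro W _ _ p _ h2 hX7 hCM hap hS
  rcases three_or_five_le p h2 with h3 | h5
  · exact stub_three W p h3 hX7 hCM hap hS
  · exact lowerHalf_five_le W p h5 hX7 hCM hap hS

end Ac2CycSqueeze

end Summit.BirchSwinnertonDyer.BirchSwinnertonDyer.Cruxes.KobayashiLowerHalfLargeImage
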